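import Literature.Computability.Complexity.PromiseCookReductions
import Literature.Computability.Complexity.OracleQueryMap
import Literature.Computability.Complexity.OracleClosure
import Literature.Computability.Complexity.PairProjections
import Literature.Computability.Complexity.ReductionsProofs
import HarnessLib

/-!
# Probabilistic polynomial-time search relative to a promise problem (`FBPP^{Π}` for search problems)

Layer `Literature/Computability/Complexity`, companion of `Oracle.lean` (`FPRel`, `BPPRel`:
the transcript model `OracleAlg` of oracle computation), `Promise.lean` (promise problems,
`PromiseBPP'`, Karp reductions `PromiseProblem.PolyTimeReducible`) and
`PromiseCookReductions.lean` (Goldreich's conformity convention `PromiseProblem.SolvedBy` and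
deterministic Cook reductions among promise problems, `PromiseProblem.CookReducible`).

**The notion.** A *search problem* is `R : {0,1}* → Set {0,1}*` (on input `x`, output some
`y ∈ R x`; Goldreich 2006, §8.2; Aaronson 2010, §1 "relational problems", the bundling of
`Literature.Computability.Cryptography.IsQSolvableRel`). `IsPSolvablePromiseRel Q R` says that
`R` is solved by a **probabilistic polynomial-time oracle machine given oracle access to the
promise problem `Q`** — a *randomised Cook reduction* of the search problem `R` to `Q` in the
sense of Goldreich 2006, §1.2, Def. 3 ("Randomized reductions are defined analogously"), with
Goldreich's convention for oracle access to a promise problem: the machine must succeed for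
EVERY total function `σ : {0,1}* → {1, 0, ⊥}` that *conforms with* `Q` (`1` on `Q.yes`, `0` on
`Q.no`, anything on instances violating the promise) — "a reduction to a promise problem should
yield the correct answer regardless of how one answers queries that violate the promise"
(p. 259). In the tree's model: `σ` is an `Oracle` with `Q.SolvedBy σ`; the machine is an
`M : OracleAlg (List Bool)` with polynomial-time step function reading its coins `r ∈ {0,1}^{k(|x|)}`
appended to the input (`boolPair x r`; Arora–Barak 2009, Def. 7.1: a PTM is a deterministic TM
with an additional random tape), run for `q(|x|)` rounds with queries of length `≤ q(|x|)` (the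
resource conventions of `FPRel`); success means: with probability `≥ 2/3` over `r` the run
outputs some `y ∈ R x` within budget (`OracleAlg.successCoins`).

## Contents

* `OracleAlg.successCoins M O n x S` — the coin strings `r` on which `M` with oracle `O`, run on
  `⟨x, r⟩` for `n` rounds, outputs a member of `S` asking only queries of length `≤ n`;
* `IsPSolvablePromiseRel Q R` — the notion; `IsPSolvableRel L R` — the special case of a
  language oracle (`Oracle.ofLanguage L`, trivial promise); `FBPPRelPromise C` — the search
  problems solvable relative to SOME promise problem of the class `C` (e.g. `C = PromiseBQP`);
* PROVED API: unfolding lemmas; monotonicity in `R`, in `Q` along special cases (Goldreich 2006,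
  §1.3) and along **Karp reductions of promise problems** (`IsPSolvablePromiseRel.of_polyTimeReducible`,
  via `OracleAlg.mapQuery` of `OracleQueryMap.lean`); `isPSolvablePromiseRel_ofLanguage_iff`
  (on `PromiseProblem.ofLanguage L` the notion is `IsPSolvableRel L`, the only conforming oracle
  being `Oracle.ofLanguage L`); `IsPSolvablePromiseRel.of_forall_conforms` (success against every
  string-valued oracle answering `[true]`/`[false]` on the promise implies the notion).

## Design notes

* **Which oracles.** Goldreich's Def. 3 offers two equivalent conventions: bit answers, arbitrary
  off the promise; or total functions into `{1, 0, ⊥}` conforming with `Q`. As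
  `PromiseProblem.CookReducible` does, we take the latter (`PromiseProblem.SolvedBy`: answers
  `[true]`, `[false]`, `[]`). Requiring success against ALL string-valued oracles that answer
  `[true]`/`[false]` on the promise (arbitrary strings elsewhere) is a priori stronger and implies
  the notion (`IsPSolvablePromiseRel.of_forall_conforms`); it is equivalent (normalise every answer
  outside `{[true], [false]}` to `[]` before the step function sees it), but the answer-normalising
  combinator is not formalised here. With `SolvedBy` all answers have length `≤ 1`, so the
  transcript model is adequate (no super-polynomially long answers; see `Oracle.lean`).
* **No guard `(R x).Nonempty`.** As for `IsQSolvableRel`, partial search problems are made total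
  by folding the promise on inputs into `R` (`R x = Set.univ` where nothing is required);
  contrast `Literature.Computability.QuantumComplexity.IsBPPSolvableRel` (adversary/`PMF` model,
  internal coins, nonemptiness guard), whose comparison with the present transcript-model
  notion is not formalised.
* **Vacuity off disjointness.** If `Q.yes` meets `Q.no` then no oracle solves `Q`
  (`PromiseProblem.SolvedBy.disjoint`) and `IsPSolvablePromiseRel Q R` holds vacuously (given any
  polynomial-time `M`); the intended `Q` (members of `PromiseBPP'`, `PromiseBQP`, …) are disjoint.
* **The simulation lemma** "`Q ∈ PromiseBPP'` and `IsPSolvablePromiseRel Q R` with `R`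
  polynomial-time checkable ⟹ `R` has a PPT solver" (the search analogue of Goldreich's remark
  after Def. 3, proved for decision problems as
  `PromiseProblem.mem_PromiseBPP'_of_cookReducible_holds` in `PromiseCookReductionsProofs.lean`
  with the machine of `PromiseCookMachine.lean`) is NOT stated here; it is problem-side work
  (route `CodeCarries`, support item `OpiGlue`).

## References

* O. Goldreich, *On promise problems: a survey*, in: Theoretical Computer Science — Essays in
  Memory of Shimon Even, LNCS 3895 (2006) 254–290: §1.2, Def. 2 (promise-BPP) and Def. 3 with the
  remark following it (pp. 258–259); §1.3 (special cases); §2.2 (approximate counting by a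
  probabilistic polynomial-time oracle machine with oracle access to the promise problem `#R^f`);
  §8.2 (search problems as promise problems) [Goldreich2006].
* S. Even, A. L. Selman, Y. Yacobi, *The complexity of promise problems with applications to
  public-key cryptography*, Inform. and Control 61 (1984) 159–173, §2 [EvenSelmanYacobi1984].
* S. Aaronson, *BQP and the polynomial hierarchy*, STOC 2010, §1 (`FBPP`, `FBQP`, relational
  problems) [Aaronson2010].
* S. Arora, B. Barak, *Computational Complexity: A Modern Approach*, CUP 2009, §3.4 (oracle
  machines), Def. 7.1 and §7.1 (PTMs as deterministic machines with a random string)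
  [AroraBarak2009].
-/

noncomputable section

namespace Literature.Computability.Complexity

open _root_.Computability Polynomial

/-! ### The success event of a coin-taking oracle algorithm -/

namespace OracleAlg

/-- `M.successCoins O n x S`: the set of coin strings `r` on which the oracle algorithm `M`
(transcript model, outputs strings) with oracle `O`, run on the input `boolPair x r` (coins
appended to the input) for at most `n` rounds, outputs some `y ∈ S` and asks only queries of
length `≤ n` (the resource conventions of `FPRel`). [Arora–Barak 2009, Def. 7.1 (random string as
extra input) with §3.4] [cite: AroraBarak2009, Def. 7.1 with §3.4] -/
def successCoins (M : OracleAlg (List Bool)) (O : Oracle) (n : ℕ) (x : List Bool)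
    (S : Set (List Bool)) : Set (List Bool) :=
  {r | ∃ y, M.run O n (boolPair x r) = some y ∧ y ∈ S ∧
    ∀ z ∈ M.queries O n (boolPair x r), z.length ≤ n}

/-- Unfolding lemma for `successCoins`. [folklore] -/
theorem mem_successCoins_iff {M : OracleAlg (List Bool)} {O : Oracle} {n : ℕ} {x : List Bool}
    {S : Set (List Bool)} {r : List Bool} :
    r ∈ M.successCoins O n x S ↔ ∃ y, M.run O n (boolPair x r) = some y ∧ y ∈ S ∧
      ∀ z ∈ M.queries O n (boolPair x r), z.length ≤ n :=
  Iff.rfl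

/-- The success event is monotone in the target set. [folklore] -/
theorem successCoins_mono (M : OracleAlg (List Bool)) (O : Oracle) (n : ℕ) (x : List Bool)
    {S S' : Set (List Bool)} (h : S ⊆ S') : M.successCoins O n x S ⊆ M.successCoins O n x S' :=
  fun _ ⟨y, hrun, hy, hq⟩ => ⟨y, hrun, h hy, hq⟩

end OracleAlg

/-! ### The notion -/

/-- `IsPSolvablePromiseRel Q R`: the search problem `R` (on input `x`, output some `y ∈ R x`) is
**solvable in probabilistic polynomial time relative to the promise problem `Q`** — a randomised
Cook reduction of `R` to `Q` (Goldreich 2006, §1.2, Def. 3, "randomized reductions are defined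
analogously", with the convention that queries violating the promise may be answered
arbitrarily; §8.2 for search problems): there are an oracle algorithm `M : OracleAlg (List Bool)`
with polynomial-time step function and polynomials `q` (round and query-length budget) and `k`
(number of coins) such that for EVERY oracle `O` conforming with `Q` (`Q.SolvedBy O`: `[true]`
on `Q.yes`, `[false]` on `Q.no`, any of `[true]`/`[false]`/`[]` elsewhere) and every input `x`,
for at least `2/3` of the coin strings `r ∈ {0,1}^{k(|x|)}` the run of `M` with `O` on
`boolPair x r` outputs some `y ∈ R x` within `q(|x|)` rounds, asking only queries of length
`≤ q(|x|)`. ("P" = probabilistic classical, as opposed to `IsQSolvableRel`; error `1/3` as in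
`BPP`.) Nothing is asserted. [cite: Goldreich2006, §1.2 Def. 3 (randomized Cook reductions to a promise problem) with §8.2] -/
def IsPSolvablePromiseRel (Q : PromiseProblem) (R : List Bool → Set (List Bool)) : Prop :=
  ∃ M : OracleAlg (List Bool), M.IsPolyTime (encodingList Bool) ∧ ∃ q k : Polynomial ℕ,
    ∀ O : Oracle, Q.SolvedBy O → ∀ x : List Bool,
      2 / 3 ≤ uniformProb (k.eval x.length) (M.successCoins O (q.eval x.length) x (R x))

/-- `IsPSolvableRel L R`: the search problem `R` is **solvable in probabilistic polynomial time
relative to the language `L`** (search-`BPP^L`, i.e. `R ∈ FBPP^L` for relations): as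
`IsPSolvablePromiseRel` with the single oracle `Oracle.ofLanguage L` (trivial promise; see
`isPSolvablePromiseRel_ofLanguage_iff`). [Aaronson 2010, §1 (FBPP, relational problems);
Arora–Barak 2009, Def. 7.1 with §3.4] [cite: Aaronson2010, §1 (FBPP, relational problems)] -/
def IsPSolvableRel (L : Language Bool) (R : List Bool → Set (List Bool)) : Prop :=
  ∃ M : OracleAlg (List Bool), M.IsPolyTime (encodingList Bool) ∧ ∃ q k : Polynomial ℕ,
    ∀ x : List Bool,
      2 / 3 ≤ uniformProb (k.eval x.length)
        (M.successCoins (Oracle.ofLanguage L) (q.eval x.length) x (R x))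

/-- `FBPPRelPromise C`: the search problems solvable in probabilistic polynomial time relative to
SOME promise problem of the class `C` (`⋃ Q ∈ C, FBPP^{Q}` for relations; e.g.
`FBPPRelPromise PromiseBQP`). [Goldreich 2006, §1.2 Def. 3; Aaronson 2010, §1] [cite: Goldreich2006, §1.2 Def. 3] -/
def FBPPRelPromise (C : Set PromiseProblem) : Set (List Bool → Set (List Bool)) :=
  {R | ∃ Q ∈ C, IsPSolvablePromiseRel Q R}

/-! ### API -/

/-- Unfolding lemma for `IsPSolvablePromiseRel` (success event spelled out).
[cite: Goldreich2006, §1.2 Def. 3] -/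
theorem isPSolvablePromiseRel_iff {Q : PromiseProblem} {R : List Bool → Set (List Bool)} :
    IsPSolvablePromiseRel Q R ↔
      ∃ M : OracleAlg (List Bool), M.IsPolyTime (encodingList Bool) ∧ ∃ q k : Polynomial ℕ,
        ∀ O : Oracle, Q.SolvedBy O → ∀ x : List Bool,
          2 / 3 ≤ uniformProb (k.eval x.length)
            {r | ∃ y, M.run O (q.eval x.length) (boolPair x r) = some y ∧ y ∈ R x ∧
              ∀ z ∈ M.queries O (q.eval x.length) (boolPair x r), z.length ≤ q.eval x.length} :=
  Iff.rfl

/-- Unfolding lemma for `IsPSolvableRel`. [cite: Aaronson2010, §1] -/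
theorem isPSolvableRel_iff {L : Language Bool} {R : List Bool → Set (List Bool)} :
    IsPSolvableRel L R ↔
      ∃ M : OracleAlg (List Bool), M.IsPolyTime (encodingList Bool) ∧ ∃ q k : Polynomial ℕ,
        ∀ x : List Bool,
          2 / 3 ≤ uniformProb (k.eval x.length)
            {r | ∃ y, M.run (Oracle.ofLanguage L) (q.eval x.length) (boolPair x r) = some y ∧
              y ∈ R x ∧ ∀ z ∈ M.queries (Oracle.ofLanguage L) (q.eval x.length) (boolPair x r),
                z.length ≤ q.eval x.length} :=
  Iff.rfl

/-- Unfolding lemma for `FBPPRelPromise`. [cite: Goldreich2006, §1.2 Def. 3] -/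
theorem mem_FBPPRelPromise_iff {C : Set PromiseProblem} {R : List Bool → Set (List Bool)} :
    R ∈ FBPPRelPromise C ↔ ∃ Q ∈ C, IsPSolvablePromiseRel Q R :=
  Iff.rfl

/-- `FBPPRelPromise` is monotone in the class of oracle problems. [folklore] -/
theorem FBPPRelPromise_mono {C D : Set PromiseProblem} (h : C ⊆ D) :
    FBPPRelPromise C ⊆ FBPPRelPromise D :=
  fun _ ⟨Q, hQ, hR⟩ => ⟨Q, h hQ, hR⟩

/-- Monotonicity of the counting probability under inclusion of events (private twin of
`PromiseCook.uniformProb_mono` of `PromiseCookMachine.lean`, not imported here).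
[cite: AroraBarak2009, §A.2] -/
private theorem uniformProb_mono' {m : ℕ} {E E' : Set (List Bool)} (h : E ⊆ E') :
    uniformProb m E ≤ uniformProb m E' := by
  classical
  unfold uniformProb
  refine div_le_div_of_nonneg_right ?_ (by positivity)
  exact_mod_cast Finset.card_le_card fun r hr => by
    simp only [Finset.mem_filter, Finset.mem_univ, true_and] at hr ⊢
    exact h hr

/-- Solving a relation solves every weaker relation: `R x ⊆ R' x` for all `x`.
[cite: Goldreich2006, §8.2 (problem restriction for search problems)] -/
theorem IsPSolvablePromiseRel.mono_right {Q : PromiseProblem} {R R' : List Bool → Set (List Bool)}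
    (h : IsPSolvablePromiseRel Q R) (hRR' : ∀ x, R x ⊆ R' x) : IsPSolvablePromiseRel Q R' := by
  obtain ⟨M, hM, q, k, h⟩ := h
  exact ⟨M, hM, q, k, fun O hO x =>
    (h O hO x).trans (uniformProb_mono' (M.successCoins_mono O _ x (hRR' x)))⟩

/-- Solving relative to `Q` solves relative to every problem `Q'` of which `Q` is a special case
(`Q.yes ⊆ Q'.yes`, `Q.no ⊆ Q'.no`): an oracle conforming with `Q'` conforms with `Q`.
[cite: Goldreich2006, §1.3 (special case of a promise problem)] -/
theorem IsPSolvablePromiseRel.mono_left {Q Q' : PromiseProblem} {R : List Bool → Set (List Bool)}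
    (h : IsPSolvablePromiseRel Q R) (hy : Q.yes ≤ Q'.yes) (hn : Q.no ≤ Q'.no) :
    IsPSolvablePromiseRel Q' R := by
  obtain ⟨M, hM, q, k, h⟩ := h
  exact ⟨M, hM, q, k, fun O hO x => h O (hO.of_subset hy hn) x⟩

/-- Solving relative to a language solves every weaker relation. [cite: Aaronson2010, §1] -/
theorem IsPSolvableRel.mono_right {L : Language Bool} {R R' : List Bool → Set (List Bool)}
    (h : IsPSolvableRel L R) (hRR' : ∀ x, R x ⊆ R' x) : IsPSolvableRel L R' := by
  obtain ⟨M, hM, q, k, h⟩ := h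
  exact ⟨M, hM, q, k, fun x => (h x).trans (uniformProb_mono' (M.successCoins_mono _ _ x (hRR' x)))⟩

/-- **The bit-answer convention implies the notion.** If one machine succeeds against EVERY
string-valued oracle answering `encodeBool true = [true]` on `Q.yes` and `encodeBool false` on
`Q.no` (arbitrary strings elsewhere), then in particular it succeeds against every oracle
conforming with `Q` in Goldreich's sense (`SolvedBy`), i.e. `IsPSolvablePromiseRel Q R`. (This
is the shape in which route statements quantify over oracles; the converse holds by normalising
answers and is not formalised.) [cite: Goldreich2006, §1.2 Def. 3 (the two formulations)] -/
theorem IsPSolvablePromiseRel.of_forall_conforms {Q : PromiseProblem}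
    {R : List Bool → Set (List Bool)}
    (h : ∃ M : OracleAlg (List Bool), M.IsPolyTime (encodingList Bool) ∧ ∃ q k : Polynomial ℕ,
      ∀ O : Oracle, (∀ z ∈ Q.yes, O z = encodeBool true) → (∀ z ∈ Q.no, O z = encodeBool false) →
        ∀ x : List Bool, 2 / 3 ≤ uniformProb (k.eval x.length)
          {r | ∃ y, M.run O (q.eval x.length) (boolPair x r) = some y ∧ y ∈ R x ∧
            ∀ z ∈ M.queries O (q.eval x.length) (boolPair x r), z.length ≤ q.eval x.length}) :
    IsPSolvablePromiseRel Q R := by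
  obtain ⟨M, hM, q, k, h⟩ := h
  exact ⟨M, hM, q, k, fun O hO x => h O (fun z hz => hO.2.1 z hz) (fun z hz => hO.2.2 z hz) x⟩

/-- **On a language (trivial promise) the notion is search-`BPP^L`**:
`IsPSolvablePromiseRel (ofLanguage L) R ↔ IsPSolvableRel L R`, the only oracle conforming with
`PromiseProblem.ofLanguage L` being `Oracle.ofLanguage L` (`solvedBy_ofLanguage_iff`).
[cite: Goldreich2006, §1.2 Def. 3 ("extends the most basic type of reductions")] -/
theorem isPSolvablePromiseRel_ofLanguage_iff {L : Language Bool} {R : List Bool → Set (List Bool)} :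
    IsPSolvablePromiseRel (PromiseProblem.ofLanguage L) R ↔ IsPSolvableRel L R := by
  constructor
  · rintro ⟨M, hM, q, k, h⟩
    exact ⟨M, hM, q, k, fun x => h _ (PromiseProblem.solvedBy_ofLanguage L) x⟩
  · rintro ⟨M, hM, q, k, h⟩
    refine ⟨M, hM, q, k, fun O hO x => ?_⟩
    rw [(PromiseProblem.solvedBy_ofLanguage_iff L O).1 hO]
    exact h x

/-- A language `L ∈ C` puts every relation solvable relative to `L` into `FBPPRelPromise` of the
promise problems of `C`. [cite: Goldreich2006, §1.1 (languages as promise problems)] -/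
theorem IsPSolvableRel.mem_FBPPRelPromise_image {C : Set (Language Bool)} {L : Language Bool}
    {R : List Bool → Set (List Bool)} (h : IsPSolvableRel L R) (hL : L ∈ C) :
    R ∈ FBPPRelPromise (PromiseProblem.ofLanguage '' C) :=
  ⟨PromiseProblem.ofLanguage L, Set.mem_image_of_mem _ hL, isPSolvablePromiseRel_ofLanguage_iff.2 h⟩

/-! ### Transport along Karp reductions of promise problems -/

namespace PSolvablePromiseRel

/-- The query extractor `⟨w, ⟨a, y⟩⟩ ↦ y` (the argument format of `OracleAlg.mapQuery`).
[folklore] -/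
def qryOf₃ (v : List Bool) : List Bool :=
  (boolUnpair (boolUnpair v).2).2

/-- The query extractor extracts the query. [folklore] -/
@[simp] theorem qryOf₃_apply (w a y : List Bool) : qryOf₃ (boolPair w (boolPair a y)) = y := by
  simp [qryOf₃]

/-- The query extractor is polynomial-time (two pairing projections). [cite: AroraBarak2009, §1.3] -/
theorem qryOf₃_mem_FP : qryOf₃ ∈ FP :=
  comp_mem_FP boolUnpairSnd_mem_FP boolUnpairSnd_mem_FP

/-- Pulling a conforming oracle back along a Karp reduction of promise problems gives a
conforming oracle: if `f` maps `Q₁.yes` into `Q₂.yes` and `Q₁.no` into `Q₂.no` and `O` conforms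
with `Q₂`, then `O ∘ f` conforms with `Q₁`. [cite: Goldreich2006, §1.2 Def. 3] -/
theorem solvedBy_comp {Q₁ Q₂ : PromiseProblem} {f : List Bool → List Bool}
    (hyes : Set.MapsTo f Q₁.yes Q₂.yes) (hno : Set.MapsTo f Q₁.no Q₂.no) {O : Oracle}
    (hO : Q₂.SolvedBy O) : Q₁.SolvedBy (O ∘ f) :=
  ⟨fun y => hO.1 (f y), fun y hy => hO.2.1 (f y) (hyes hy), fun y hy => hO.2.2 (f y) (hno hy)⟩

/-- Asking `f y` of `O` instead of `y` of `O ∘ f` gets the same answers (`MapAgree` for the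
rewriting `f ∘ qryOf₃`, at every round). [folklore] -/
theorem mapAgree_comp (M : OracleAlg (List Bool)) (f : List Bool → List Bool) (O : Oracle)
    (w : List Bool) : M.MapAgree (f ∘ qryOf₃) O (O ∘ f) w := by
  intro i y _ _
  simp only [Function.comp_apply, qryOf₃_apply]

/-- An `FP` function has polynomially bounded output length (private twin of
`exists_poly_length_le_of_mem_FP` of `CountingHierarchyProofs.lean`, not imported here).
[cite: AroraBarak2009, §1.3] -/
private theorem exists_poly_length_le_of_mem_FP' {f : List Bool → List Bool} (hf : f ∈ FP) :
    ∃ s : Polynomial ℕ, ∀ x, (f x).length ≤ s.eval x.length := by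
  obtain ⟨p, M, hM⟩ := hf
  refine ⟨X + C (TM2Comp.machinePushBound M.tm) * p, fun x => ?_⟩
  have h := (hM x).length_le
  simpa using h

/-- Evaluation of a polynomial over `ℕ` is monotone in the argument (private twin of
`natPoly_eval_mono` of `CircuitLowerBounds.lean`). [folklore] -/
private theorem natPoly_eval_mono' (p : Polynomial ℕ) {a b : ℕ} (h : a ≤ b) :
    p.eval a ≤ p.eval b := by
  rw [Polynomial.eval_eq_sum_range, Polynomial.eval_eq_sum_range]
  exact Finset.sum_le_sum fun i _ => Nat.mul_le_mul_left _ (Nat.pow_le_pow_left h i)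

end PSolvablePromiseRel

open PSolvablePromiseRel in
/-- **Transport along Karp reductions of promise problems.** If `Q₁` Karp-reduces to `Q₂`
(`f ∈ FP` mapping YES to YES and NO to NO, Goldreich's Def. 3) then every search problem
solvable relative to `Q₁` is solvable relative to `Q₂`: ask `f y` instead of `y`
(`OracleAlg.mapQuery`, polynomial-time by `isPolyTime_mapQuery`); an oracle `O` conforming with
`Q₂` answers these as the conforming oracle `O ∘ f` of `Q₁` answers the original queries, so
the runs coincide (`run_mapQuery`), with the same coins, the same rounds, and queries of length
`≤ s(q(|x|))` for an output-length bound `s` of `f`; budget `q + s ∘ q`.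
[cite: Goldreich2006, §1.2 Def. 3 (Karp and Cook reductions among promise problems)] -/
theorem IsPSolvablePromiseRel.of_polyTimeReducible {Q₁ Q₂ : PromiseProblem}
    {R : List Bool → Set (List Bool)} (h : IsPSolvablePromiseRel Q₁ R)
    (h₁₂ : Q₁.PolyTimeReducible Q₂) : IsPSolvablePromiseRel Q₂ R := by
  obtain ⟨M, hM, q, k, h⟩ := h
  obtain ⟨f, hf, hyes, hno⟩ := h₁₂
  obtain ⟨s, hs⟩ := exists_poly_length_le_of_mem_FP' hf
  refine ⟨M.mapQuery (f ∘ qryOf₃),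
    OracleAlg.isPolyTime_mapQuery _ hM (comp_mem_FP hf qryOf₃_mem_FP), q + s.comp q, k,
    fun O hO x => ?_⟩
  have hO₁ : Q₁.SolvedBy (O ∘ f) := solvedBy_comp hyes hno hO
  refine (h (O ∘ f) hO₁ x).trans (uniformProb_mono' ?_)
  rintro r ⟨y, hrun, hy, hqs⟩
  have hagree := mapAgree_comp M f O (boolPair x r)
  have hrun' : (M.mapQuery (f ∘ qryOf₃)).run O (q.eval x.length) (boolPair x r) = some y := by
    rw [OracleAlg.run_mapQuery _ _ _ _ _ hagree]
    exact hrun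
  have hle : q.eval x.length ≤ (q + s.comp q).eval x.length := by
    rw [eval_add]
    exact Nat.le_add_right _ _
  refine ⟨y, OracleAlg.run_mono _ _ _ hle hrun', hy, fun z hz => ?_⟩
  rw [OracleAlg.queries_eq_of_run_eq_some _ _ _ hle hrun'] at hz
  obtain ⟨i, y', -, -, hy', rfl⟩ := OracleAlg.queries_mapQuery _ _ _ _ _ hagree _ hz
  rw [Function.comp_apply, qryOf₃_apply, eval_add, eval_comp]
  calc (f y').length ≤ s.eval y'.length := hs y'
    _ ≤ s.eval (q.eval x.length) := natPoly_eval_mono' s (hqs y' hy')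
    _ ≤ q.eval x.length + s.eval (q.eval x.length) := Nat.le_add_left _ _

/-- `FBPPRelPromise` along Karp reductions: if every problem of `C` Karp-reduces to some problem
of `D`, then `FBPPRelPromise C ⊆ FBPPRelPromise D`. [cite: Goldreich2006, §1.2 Def. 3] -/
theorem FBPPRelPromise_subset_of_forall_polyTimeReducible {C D : Set PromiseProblem}
    (h : ∀ Q ∈ C, ∃ Q' ∈ D, Q.PolyTimeReducible Q') : FBPPRelPromise C ⊆ FBPPRelPromise D := by
  rintro R ⟨Q, hQ, hR⟩
  obtain ⟨Q', hQ', hQQ'⟩ := h Q hQ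
  exact ⟨Q', hQ', hR.of_polyTimeReducible hQQ'⟩

end Literature.Computability.Complexity

end
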